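import Summits.CriticalPhenomena.PercolationContinuityZ3.Theorems.PercNearOneGluingNoHeavyPcintChainBondEvent
import HarnessLib

/-!
# PCINT lane, reduction B3c (`chordchain_cw`, bond chain bookkeeping): `θ(p) ≤ Σ_{γ ∈ SAW_n} chainBondWeight p s kc γ`

Cell `prim-pcint` (PAPER-2 track (iii): certified intervals for `p_c(ℤ^d)`), seat `prim-pcint-2` (gen 4); support file
(`--supports stmt-CriticalPhenomena-4575`).  Does NOT build on p205010.  Memo: `run/shared/lean/prim/pcint/REDUCTIONS.md` §B3c.

The B3c refinement of the chord bound for bond percolation on `ℤ^d`: for `0 ≤ p ≤ 1/2`, `0 ≤ s ≤ 1`, `s² ≥ 1 - p²`, `kc ≥ 2`,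
`θ(p) ≤ Σ_{γ ∈ SAW_n} pⁿ (1-p)^{#chordEdges γ} s^{detTotal kc γ} ((1+s²)/2)^{cornerTotal γ}` for every `n`
(`theta_le_sum_chainBondWeight`), where `detTotal` (`…ChainBondUnits`) pays the unit `s` for EVERY linked incidence of an
off-path site (base + chain-start bonus) instead of B3r's one unit per incidence after the first, and each genuine corner is
averaged with two units, `(1+s²)/2` instead of `(1+s)/2`.  Proof: per family `o` of sibling orders, the code-least open
geodesic realises `chainEvent o γ` (`…ChainBondEvent`); its probability factorises over the path and the off-path sites
(edge-disjoint finitely determined events, `bondPercolation_real_biInter_eq_prod` of `…ChordRandReduction`); each site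
contributes at most `s^{detUnits + 2·#badFiber}` (`real_siteEvt_le_pow`); the bad-corner indicators average to `((1+s²)/2)`
per corner (`sum_orders_pow_card_badTimes` with `q = s²`).  Glue: `le_criticalProb_zd_of_chainBond_le_geometric`.
-/

noncomputable section

namespace Summit.CriticalPhenomena.PercolationContinuityZ3.Theorems.Pcint

open Finset MeasureTheory Literature.Probability.Percolation Literature.Probability.LatticeModels

variable {d n : ℕ}

namespace ChainBond

/-- **The probability of the B3c event**: `P(chainEvent o γ) ≤ pⁿ (1-p)^{#chords} s^{detTotal} (s²)^{#badTimes o γ}`.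
[folklore] -/
theorem real_chainEvent_le (p : unitInterval) {s : ℝ} (hp : (p : ℝ) ≤ 1 / 2) (hs0 : 0 ≤ s) (hs1 : s ≤ 1)
    (hps : 1 - (p : ℝ) ^ 2 ≤ s ^ 2) {kc : ℕ} (hkc : 2 ≤ kc) (o : Orders d n) {γ : Fin n → Fin d × Bool} (hsaw : IsSAW γ) :
    (bondPercolation (zdGraph d) p).real (chainEvent o γ) ≤
      (p : ℝ) ^ n * (1 - p : ℝ) ^ (chordEdges γ).card * s ^ detTotal kc γ * (s ^ 2) ^ (badTimes o γ).card := by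
  classical
  set μ := bondPercolation (zdGraph d) p with hμ
  have hbase := determinedBy_baseEvt γ
  have hsites : DeterminedBy (⋂ w ∈ offSites γ, siteEvt o γ w)
      (↑((offSites γ).biUnion (incEdges γ)) : Set (Sym2 (Site d))) :=
    DeterminedBy.biInter_finset fun w _ => determinedBy_siteEvt o γ w
  have hoff : ∀ w ∈ offSites γ, w ∉ pathSites γ := fun w hw => (mem_offSites.1 hw).1
  have hdisj : Disjoint (wordEdges γ ∪ chordEdges γ) ((offSites γ).biUnion (incEdges γ)) := by
    rw [disjoint_biUnion_right]
    exact fun w hw => disjoint_base_incEdges (hoff w hw)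
  have hprob : μ.real (chainEvent o γ) = μ.real (baseEvt γ) * ∏ w ∈ offSites γ, μ.real (siteEvt o γ w) := by
    rw [chainEvent, hμ, bondPercolation_real_inter_of_disjoint (zdGraph d) p (disjoint_coe.2 hdisj) hbase hsites
        hbase.measurableSet_of_finset hsites.measurableSet_of_finset,
      bondPercolation_real_biInter_eq_prod p (offSites γ) (siteEvt o γ) (incEdges γ)
        (fun w _ => determinedBy_siteEvt o γ w) (fun w hw w' _ hne => incEdges_disjoint hsaw (hoff w hw) hne)]
  have hbaseP : μ.real (baseEvt γ) = (p : ℝ) ^ n * (1 - p : ℝ) ^ (chordEdges γ).card := by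
    rw [hμ, baseEvt, bondPercolation_real_open_closed _ _ (wordEdges_subset_edgeSet γ) (chordEdges_subset_edgeSet γ)
      (IsSAW.disjoint_wordEdges_chordEdges hsaw), hsaw.card_wordEdges]
  have hsiteP : ∏ w ∈ offSites γ, μ.real (siteEvt o γ w) ≤
      ∏ w ∈ offSites γ, s ^ (detUnits kc γ w + 2 * (badFiber o γ w).card) :=
    prod_le_prod (fun w _ => measureReal_nonneg) fun w hw => by
      rw [hμ]; exact real_siteEvt_le_pow p hp hs0 hs1 hps hkc hsaw (hoff w hw)
  have hexp : ∏ w ∈ offSites γ, s ^ (detUnits kc γ w + 2 * (badFiber o γ w).card) =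
      s ^ detTotal kc γ * (s ^ 2) ^ (badTimes o γ).card := by
    rw [prod_pow_eq_pow_sum, sum_add_distrib, pow_add, detTotal, ← mul_sum, pow_mul, sum_card_badFiber]
  rw [hprob, hbaseP]
  calc (p : ℝ) ^ n * (1 - p : ℝ) ^ (chordEdges γ).card * ∏ w ∈ offSites γ, μ.real (siteEvt o γ w)
      ≤ (p : ℝ) ^ n * (1 - p : ℝ) ^ (chordEdges γ).card * ∏ w ∈ offSites γ, s ^ (detUnits kc γ w + 2 * (badFiber o γ w).card) :=
        mul_le_mul_of_nonneg_left hsiteP (mul_nonneg (pow_nonneg p.2.1 _) (pow_nonneg (sub_nonneg.2 p.2.2) _))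
    _ = _ := by rw [hexp]; ring

/-- Per family of orders: `θ(p) ≤ Σ_{γ SAW} pⁿ (1-p)^{#chords} s^{detTotal} (s²)^{#badTimes o γ}`. [folklore] -/
theorem theta_le_sum_of_orders_chain (p : unitInterval) (o : Orders d n) {s : ℝ} (hp : (p : ℝ) ≤ 1 / 2) (hs0 : 0 ≤ s)
    (hs1 : s ≤ 1) (hps : 1 - (p : ℝ) ^ 2 ≤ s ^ 2) {kc : ℕ} (hkc : 2 ≤ kc) :
    theta (zdGraph d) 0 p ≤ ∑ γ ∈ sawWords d n,
      (p : ℝ) ^ n * (1 - p : ℝ) ^ (chordEdges γ).card * s ^ detTotal kc γ * (s ^ 2) ^ (badTimes o γ).card := by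
  classical
  set μ := bondPercolation (zdGraph d) p with hμ
  set bad : Set (BondConfig (Site d)) := {ω | ¬ ω ⊆ (zdGraph d).edgeSet} with hbad
  have hbad0 : μ.real bad = 0 := by
    rw [measureReal_eq_zero_iff]
    have := ProbabilityTheory.setBernoulli_ae_subset (u := (zdGraph d).edgeSet) (p := p)
    rw [Filter.Eventually, mem_ae_iff, Set.compl_setOf] at this
    exact this
  calc theta (zdGraph d) 0 p = μ.real (percolatesAt 0) := rfl
    _ ≤ μ.real ((⋃ γ ∈ sawWords d n, chainEvent o γ) ∪ bad) :=
        measureReal_mono (percolatesAt_subset_biUnion_chainEvent o)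
    _ ≤ μ.real (⋃ γ ∈ sawWords d n, chainEvent o γ) + μ.real bad := measureReal_union_le _ _
    _ = μ.real (⋃ γ ∈ sawWords d n, chainEvent o γ) := by rw [hbad0, add_zero]
    _ ≤ ∑ γ ∈ sawWords d n, μ.real (chainEvent o γ) := measureReal_biUnion_finset_le _ _
    _ ≤ _ := sum_le_sum fun γ hγ => ?_
  rw [hμ]
  exact real_chainEvent_le p hp hs0 hs1 hps hkc o (mem_sawWords.1 hγ)

/-- **Reduction B3c** (certificate kind `chordchain_cw`, full-information form).  For `0 ≤ p ≤ 1/2`, `0 ≤ s ≤ 1` with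
`s² ≥ 1 - p²` and a chain parameter `kc ≥ 2`:
`θ(p) ≤ Σ_{γ ∈ SAW_n} pⁿ (1-p)^{#chordEdges γ} s^{detTotal kc γ} ((1+s²)/2)^{cornerTotal γ}`. [folklore] -/
theorem theta_le_sum_chainBondWeight (d n : ℕ) (p : unitInterval) {s : ℝ} (hp : (p : ℝ) ≤ 1 / 2) (hs0 : 0 ≤ s)
    (hs1 : s ≤ 1) (hps : 1 - (p : ℝ) ^ 2 ≤ s ^ 2) {kc : ℕ} (hkc : 2 ≤ kc) :
    theta (zdGraph d) 0 p ≤ ∑ γ ∈ sawWords d n, chainBondWeight p s kc γ := by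
  classical
  have ho := fun o : Orders d n => theta_le_sum_of_orders_chain p o hp hs0 hs1 hps hkc
  have hO : (0 : ℝ) < Fintype.card (Orders d n) := Nat.cast_pos.2 Fintype.card_pos
  have hsum := sum_le_sum fun (o : Orders d n) (_ : o ∈ univ) => ho o
  rw [sum_const, card_univ, nsmul_eq_mul, sum_comm] at hsum
  have key : ∑ γ ∈ sawWords d n, ∑ o : Orders d n,
      (p : ℝ) ^ n * (1 - p : ℝ) ^ (chordEdges γ).card * s ^ detTotal kc γ * (s ^ 2) ^ (badTimes o γ).card
      = Fintype.card (Orders d n) * ∑ γ ∈ sawWords d n, chainBondWeight p s kc γ := by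
    rw [mul_sum]
    refine sum_congr rfl fun γ _ => ?_
    rw [← mul_sum, sum_orders_pow_card_badTimes, chainBondWeight]
    ring
  rw [key] at hsum
  exact le_of_mul_le_mul_left hsum hO

/-! ### Certificate glue -/

/-- **Certificate glue (B3c).** If `Σ_{γ ∈ SAW_n} chainBondWeight p s kc γ ≤ C rⁿ` for all `n` with `r < 1`, then
`θ(p) = 0`. [folklore] -/
theorem theta_zd_eq_zero_of_chainBond_le_geometric (d : ℕ) (p : unitInterval) {s C r : ℝ} {kc : ℕ}
    (hp : (p : ℝ) ≤ 1 / 2) (hs0 : 0 ≤ s) (hs1 : s ≤ 1) (hps : 1 - (p : ℝ) ^ 2 ≤ s ^ 2) (hkc : 2 ≤ kc)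
    (hr0 : 0 ≤ r) (hr : r < 1) (h : ∀ n, ∑ γ ∈ sawWords d n, chainBondWeight p s kc γ ≤ C * r ^ n) :
    theta (zdGraph d) 0 p = 0 := by
  have ht : Filter.Tendsto (fun n : ℕ => C * r ^ n) Filter.atTop (nhds 0) := by
    simpa using (tendsto_pow_atTop_nhds_zero_of_lt_one hr0 hr).const_mul C
  exact le_antisymm (ge_of_tendsto' ht fun n => (theta_le_sum_chainBondWeight d n p hp hs0 hs1 hps hkc).trans (h n))
    measureReal_nonneg

/-- **Certificate glue (B3c), threshold form**: under the same hypothesis, `p ≤ p_c^bond(ℤ^d)`. [folklore] -/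
theorem le_criticalProb_zd_of_chainBond_le_geometric (d : ℕ) (p : unitInterval) {s C r : ℝ} {kc : ℕ}
    (hp : (p : ℝ) ≤ 1 / 2) (hs0 : 0 ≤ s) (hs1 : s ≤ 1) (hps : 1 - (p : ℝ) ^ 2 ≤ s ^ 2) (hkc : 2 ≤ kc)
    (hr0 : 0 ≤ r) (hr : r < 1) (h : ∀ n, ∑ γ ∈ sawWords d n, chainBondWeight p s kc γ ≤ C * r ^ n) :
    (p : ℝ) ≤ criticalProb (zdGraph d) 0 := by
  have h0 := theta_zd_eq_zero_of_chainBond_le_geometric d p hp hs0 hs1 hps hkc hr0 hr h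
  refine le_csInf ⟨1, Or.inr rfl⟩ ?_
  rintro q (⟨hq, hpos⟩ | hq)
  · by_contra hlt
    push Not at hlt
    have hmono := theta_mono_holds (zdGraph d) (0 : Site d) (show (⟨q, hq⟩ : unitInterval) ≤ p from hlt.le)
    have : theta (zdGraph d) 0 ⟨q, hq⟩ ≤ 0 := hmono.trans_eq h0
    exact hpos.not_ge this
  · rw [Set.mem_singleton_iff] at hq
    rw [hq]
    exact p.2.2

end ChainBond

end Summit.CriticalPhenomena.PercolationContinuityZ3.Theorems.Pcint
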